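import Summits.QuantumAdvantage.QuantumAdvantage.Theses.DWalkThree
import Summits.QuantumAdvantage.AdviceFreeQNC0.ConstantBellsDense
import Summits.QuantumAdvantage.AdviceFreeQNC0.CleanGapStrategies
import Summits.QuantumAdvantage.AdviceFreeQNC0.WalkTransport
import HarnessLib

/-!
# Route DWalkThree, support R0 `RingFixedBellsSharp3` (stmt-QuantumAdvantage-22487): every CONSTANT strategy obeys the `2/3` law

R0 (planner qa-qnc0-p1 g16/g17, ROUND-15 §9.7): for `N ≥ 3` and ANY fixed bell set `B ⊆ Fin N`, the constant strategy
`tGuess ⊕ 1_B` wins the `N`-cycle relation `RingHLF.Rel` on at most `(2/3)·2^{N−1} + (1/3)·2^{N − ⌊(N−20)/21⌋}` inputs of the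
odd class: `3·#win ≤ 2·2^{N−1} + 2^{N − (N−20)/21}`.
* SPARSE (`|B| ≤ 20`): among the `21` disjoint cut blocks `[t(m+1), t(m+1)+m)`, `t < 21`, `m = ⌊(N−20)/21⌋` (`21m + 20 ≤ N`), one is
  bell-free (pigeonhole); transport to u-coordinates and qn-prover g3's clean-gap lemma `ringWinU_cleanGap_le`
  (as in the landed `fixedBellsInnerGap3`) give `3·#win ≤ 2^N + 2^{N−m}`.
* DENSE (`|B| ≥ 21`): transport to u-coordinates (`WalkTransport.rel_iff_ringWinU`: on the odd class the ring game of
  `tGuess ⊕ 1_B` is α's u-walk game of the CONSTANT selector `[g ∈ B]`, and `uVec` is injective there), then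
  `ConstBells.three_mul_card_win_le` (transfer-matrix pair contraction `5/8`, ten pairs): `3·#win ≤ 2·2^{N−1}`.
WHAT THIS IS NOT: nothing on adaptive strategies (THEOREM A `RingBShot3`, the dense residual `RingDenseResidualLt3`); this is
one hypothesis of the route's `closes`; rung F-Q2-odd (p = 3), separation NOT moved.
-/

noncomputable section

set_option linter.dupNamespace false

namespace Summit.QuantumAdvantage.QuantumAdvantage.Theorems

open Finset Literature.Computability.QuantumComplexity Literature.Computability.QuantumComplexity.RingHLF
open Summit.QuantumAdvantage.AdviceFreeQNC0

/-- Pigeonhole: at most `20` bells among the cuts `0 … N−1` leave a bell-free run of `⌊(N−20)/21⌋` consecutive cuts. -/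
theorem dWalkThree_exists_bellFree_run {N : ℕ} (B : Finset (Fin N)) (hB : B.card ≤ 20) :
    ∃ a : ℕ, a + (N - 20) / 21 ≤ N ∧ ∀ k : Fin N, (a ≤ k.val ∧ k.val < a + (N - 20) / 21) → k ∉ B := by
  classical
  set m := (N - 20) / 21 with hm
  have hm21 : 21 * m + 20 ≤ N ∨ N < 20 := by omega
  by_contra hcon
  push Not at hcon
  -- every block `[t(m+1), t(m+1)+m)`, `t < 21`, contains a bell
  have hblk : ∀ t : ℕ, t < 21 → ∃ k : Fin N, (t * (m + 1) ≤ k.val ∧ k.val < t * (m + 1) + m) ∧ k ∈ B := by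
    intro t ht
    have hle : t * (m + 1) + m ≤ N := by
      rcases hm21 with h | h
      · have : t * (m + 1) ≤ 20 * (m + 1) := Nat.mul_le_mul_right _ (by omega)
        omega
      · have hm0 : m = 0 := by omega
        rw [hm0]
        rcases Nat.eq_zero_or_pos N with hN | hN
        · -- no bells at all in `Fin 0`; the block is empty anyway
          obtain ⟨k, hk, _⟩ := hcon 0 (by omega)
          exact absurd k.isLt (by omega)
        · -- `m = 0`: the hypothesis `hcon 0` already fails
          obtain ⟨k, hk, _⟩ := hcon 0 (by omega)
          omega
    obtain ⟨k, hk, hkB⟩ := hcon (t * (m + 1)) hle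
    exact ⟨k, hk, hkB⟩
  choose f hf using hblk
  -- the `21` bells so found are distinct
  have hinj : ∀ t₁ (h₁ : t₁ < 21) t₂ (h₂ : t₂ < 21), f t₁ h₁ = f t₂ h₂ → t₁ = t₂ := by
    intro t₁ h₁ t₂ h₂ heq
    have a1 := (hf t₁ h₁).1
    have a2 := (hf t₂ h₂).1
    rw [heq] at a1
    by_contra hne
    rcases Nat.lt_or_gt_of_ne hne with hlt | hlt
    · have : (t₁ + 1) * (m + 1) ≤ t₂ * (m + 1) := Nat.mul_le_mul_right _ hlt
      rw [Nat.add_mul, one_mul] at this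
      omega
    · have : (t₂ + 1) * (m + 1) ≤ t₁ * (m + 1) := Nat.mul_le_mul_right _ hlt
      rw [Nat.add_mul, one_mul] at this
      omega
  have hcard : 21 ≤ B.card := by
    calc 21 = (Finset.range 21).card := (Finset.card_range 21).symm
      _ ≤ B.card := by
        refine Finset.card_le_card_of_injOn (fun t => if h : t < 21 then f t h else f 0 (by norm_num))
          (fun t ht => ?_) (fun t₁ ht₁ t₂ ht₂ heq => ?_)
        · rw [Finset.mem_coe, Finset.mem_range] at ht
          simp only [dif_pos ht, Finset.mem_coe]
          exact (hf t ht).2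
        · rw [Finset.mem_coe, Finset.mem_range] at ht₁ ht₂
          simp only [dif_pos ht₁, dif_pos ht₂] at heq
          exact hinj t₁ ht₁ t₂ ht₂ heq
  omega

open Summit.QuantumAdvantage.QuantumAdvantage.Theses.DWalkThree in
/-- **R0 `RingFixedBellsSharp3` — PROVED**: every constant strategy `tGuess ⊕ 1_B` wins on at most
`(2/3)·2^{N−1} + (1/3)·2^{N−⌊(N−20)/21⌋}` odd-class inputs of the `N`-cycle (`N ≥ 3`). -/
theorem dWalkThree_ringFixedBellsSharp3 :
    Summit.QuantumAdvantage.QuantumAdvantage.Theses.DWalkThree.RingFixedBellsSharp3 := by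
  unfold RingFixedBellsSharp3
  intro N hN B
  classical
  -- the win set, with the computable decidability of `FixedBellsGap`
  have hset : (univ.filter fun x : Fin N → Bool => OddZeros x ∧
      Rel x (fun k => xor (tGuess x k) (decide (k ∈ B)))) =
      (univ.filter fun x : Fin N → Bool => (univ.filter fun b : Fin N => x b = false).card % 2 = 1 ∧
        Rel x (fun k => xor (tGuess x k) (decide (k ∈ B)))) := by
    ext x; simp only [mem_filter, mem_univ, true_and, OddZeros]
  rw [hset]
  by_cases hB : B.card ≤ 20
  · -- SPARSE: a bell-free run of `m` cuts; transport and the clean-gap lemma (as in `fixedBellsInnerGap3`)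
    obtain ⟨a, ham, hgapB⟩ := dWalkThree_exists_bellFree_run B hB
    obtain ⟨m, hm⟩ : ∃ m, m = (N - 20) / 21 := ⟨_, rfl⟩
    rw [← hm] at ham hgapB ⊢
    obtain ⟨p, q, hpa, rfl⟩ : ∃ p q : ℕ, (∀ g : ℕ, p < g → g < p + m → ∃ a, (a ≤ g ∧ g < a + m) ∧
        ∀ k : Fin N, (a ≤ k.val ∧ k.val < a + m) → k ∉ B) ∧ N = p + m + q + 1 :=
      ⟨a - 1, N - 1 - (a - 1) - m, fun g h1 h2 => ⟨a, ⟨by omega, by omega⟩, hgapB⟩, by omega⟩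
    set y : Fin (p + m + q + 1) → (Fin (p + m + q) → Bool) → Bool := fun g _ => decide (g ∈ B) with hy
    have hgap : ∀ g : Fin (p + m + q + 1), p < g.val → g.val < p + m → ∀ w, y g w = false := by
      intro g h1 h2 w
      obtain ⟨a', hag, hgapB'⟩ := hpa g.val h1 h2
      simp only [hy, decide_eq_false_iff_not]
      exact hgapB' g hag
    have hloc : ∀ (g : Fin (p + m + q + 1)) (a' : Fin p → Bool) (v v' : Fin m → Bool) (b : Fin q → Bool),
        y g (glue3 a' v b) = y g (glue3 a' v' b) := fun _ _ _ _ _ => rfl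
    have hGap := ringWinU_cleanGap_le (p + m + q + 2) y hgap hloc
    set z : (Fin (p + m + q + 1) → Bool) → (Fin (p + m + q + 1) → Bool) :=
      fun x k => xor (tGuess x k) (decide (k ∈ B)) with hz
    have hy' : (fun (g : Fin (p + m + q + 1)) (u : Fin (p + m + q) → Bool) =>
        xor (z (xOfU u) g) (tGuess (xOfU u) g)) = y := by
      funext g u
      simp only [hz, hy]
      generalize tGuess (xOfU u) g = t
      generalize decide (g ∈ B) = d
      cases t <;> cases d <;> rfl
    have hinj : (univ.filter fun x : Fin (p + m + q + 1) → Bool =>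
          (univ.filter fun b : Fin (p + m + q + 1) => x b = false).card % 2 = 1 ∧ Rel x (z x)).card ≤
        (univ.filter fun w : Fin (p + m + q) → Bool => ringWinU (p + m + q + 2) y w = true).card := by
      refine Finset.card_le_card_of_injOn uVec ?_ ?_
      · intro x hx
        rw [Finset.mem_coe, mem_filter] at hx
        rw [Finset.mem_coe, mem_filter]
        refine ⟨mem_univ _, ?_⟩
        have h := (rel_iff_ringWinU (by omega) x hx.2.1 z).1 hx.2.2
        rwa [hy'] at h
      · intro x₁ hx₁ x₂ hx₂ h
        rw [Finset.mem_coe, mem_filter] at hx₁ hx₂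
        rw [← xOfU_uVec (by omega) x₁ hx₁.2.1, ← xOfU_uVec (by omega) x₂ hx₂.2.1, h]
    -- arithmetic: `2·2^{p+m+q} + 2·2^{p+q} = 2·2^{N-1} + 2^{N-m}`
    have hpow : 2 * 2 ^ (p + m + q) + 2 * 2 ^ (p + q) =
        2 * 2 ^ (p + m + q + 1 - 1) + 2 ^ (p + m + q + 1 - m) := by
      rw [Nat.add_sub_cancel, show p + m + q + 1 - m = (p + q) + 1 from by omega, pow_succ]
      ring
    calc 3 * (univ.filter fun x : Fin (p + m + q + 1) → Bool =>
            (univ.filter fun b : Fin (p + m + q + 1) => x b = false).card % 2 = 1 ∧ Rel x (z x)).card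
        ≤ 3 * (univ.filter fun w : Fin (p + m + q) → Bool => ringWinU (p + m + q + 2) y w = true).card :=
          Nat.mul_le_mul_left 3 hinj
      _ ≤ 2 * 2 ^ (p + m + q) + 2 * 2 ^ (p + q) := hGap
      _ = 2 * 2 ^ (p + m + q + 1 - 1) + 2 ^ (p + m + q + 1 - m) := hpow
  · -- DENSE: transport to the u-walk game of the constant selector and the transfer-matrix bound
    push Not at hB
    obtain ⟨n, rfl⟩ : ∃ n, N = n + 1 := ⟨N - 1, by omega⟩
    set z : (Fin (n + 1) → Bool) → (Fin (n + 1) → Bool) := fun x k => xor (tGuess x k) (decide (k ∈ B)) with hz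
    have hy' : (fun (g : Fin (n + 1)) (u : Fin n → Bool) => xor (z (xOfU u) g) (tGuess (xOfU u) g)) =
        ConstBells.constY B := by
      funext g u
      simp only [hz, ConstBells.constY]
      generalize tGuess (xOfU u) g = t
      generalize decide (g ∈ B) = d
      cases t <;> cases d <;> rfl
    have hinj : (univ.filter fun x : Fin (n + 1) → Bool =>
          (univ.filter fun b : Fin (n + 1) => x b = false).card % 2 = 1 ∧ Rel x (z x)).card ≤
        (univ.filter fun w : Fin n → Bool => ringWinU (n + 2) (ConstBells.constY B) w = true).card := by
      refine Finset.card_le_card_of_injOn uVec ?_ ?_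
      · intro x hx
        rw [Finset.mem_coe, mem_filter] at hx
        rw [Finset.mem_coe, mem_filter]
        refine ⟨mem_univ _, ?_⟩
        have h := (rel_iff_ringWinU (by omega) x hx.2.1 z).1 hx.2.2
        rwa [hy'] at h
      · intro x₁ hx₁ x₂ hx₂ h
        rw [Finset.mem_coe, mem_filter] at hx₁ hx₂
        rw [← xOfU_uVec (by omega) x₁ hx₁.2.1, ← xOfU_uVec (by omega) x₂ hx₂.2.1, h]
    have hdense := ConstBells.three_mul_card_win_le (n + 2) B (by omega)
    have hpow : 2 * 2 ^ n ≤ 2 * 2 ^ (n + 1 - 1) + 2 ^ (n + 1 - (n + 1 - 20) / 21) := by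
      rw [Nat.add_sub_cancel]; exact Nat.le_add_right _ _
    calc 3 * (univ.filter fun x : Fin (n + 1) → Bool =>
            (univ.filter fun b : Fin (n + 1) => x b = false).card % 2 = 1 ∧ Rel x (z x)).card
        ≤ 3 * (univ.filter fun w : Fin n → Bool => ringWinU (n + 2) (ConstBells.constY B) w = true).card :=
          Nat.mul_le_mul_left 3 hinj
      _ ≤ 2 * 2 ^ n := hdense
      _ ≤ 2 * 2 ^ (n + 1 - 1) + 2 ^ (n + 1 - (n + 1 - 20) / 21) := hpow

end Summit.QuantumAdvantage.QuantumAdvantage.Theorems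

end
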